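import Literature.Topology.FourManifolds.BoundaryConnectedSum
import Literature.Topology.FourManifolds.BoundaryConnectedSumExistence
import Literature.AlgebraicTopology.Homotopy.CollaredDeformationRetract
import Mathlib.Topology.Homotopy.Contractible
import Mathlib.Topology.Homotopy.Equiv
import HarnessLib

/-!
# A boundary connected sum of contractible manifolds is contractible

Topic `Literature/Topology/FourManifolds`. This file **discharges the named fact**
`Literature.Topology.FourManifolds.contractibleSpace_of_isOpenGluing_boundaryConnectedSumRel` of `BoundaryConnectedSum.lean`
(leaf "BCS contractible" under Matveyev's cork decomposition `Literature.Topology.FourManifolds.Matveyev1996_decomposition` /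
`Literature.Topology.FourManifolds.corkDecomposition`: Matveyev's new corks `W₁ ♮ W₂` are contractible):

* `Literature.Topology.FourManifolds.contractibleSpace_of_isOpenGluing_boundaryConnectedSumRel_holds`.

**Statement.** If `P` is an open gluing of `X ∖ {h₁ 0}` and `Y ∖ {h₂ 0}` along Juhász's relation
`boundaryConnectedSumRel h₁ h₂` (`h₁ (t v) ∼ h₂ ((1 - t) v)`, `‖v‖ = 1`, `0 < t < 1`) for
half-discs `h₁ : ℝⁿ₊ ↪ X`, `h₂ : ℝⁿ₊ ↪ Y` with open ranges, and `X`, `Y` are contractible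
(Hausdorff), then `P` is contractible. Only the topology of the data is used (`Literature.Topology.FourManifolds.BCSData`).

**Proof.** Write `t` for the `h₁`-radius of a point `jA (h₁ (t v)) = jB (h₂ ((1 - t) v))` of the
neck. Put `X' := P ∖ jB (Y ∖ h₂ {‖w‖ ≤ 1/2})` (the points with `t ≥ 1/2` together with the far
part of `X`) and `Y' := P ∖ jA (X ∖ h₁ {‖w‖ ≤ 1/2})` (`t ≤ 1/2` and the far part of `Y`). Then
(§4) `X'`, `Y'` are closed, `X' ∪ Y' = P` (`BCSData.outerA_inter_outerB`), `X' ∩ Y'` is the seam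
`{t = 1/2} = jA (h₁ (S/2))`, `S = {v ∈ ℝⁿ₊ | ‖v‖ = 1}` the unit hemisphere, and
`κ (v, s) := jA (h₁ ((1/2 - s/4) v))` is a collar of the seam inside `Y'` with
`Y' ∖ κ (S × [0, 1)) = P ∖ jA (X ∖ h₁ {‖w‖ ≤ 1/4})` closed (`BCSData.collaredCover`). Moreover:
1. `X' = jA (X ∖ h₁ {‖w‖ < 1/2}) ≅ X ∖ h₁ {‖w‖ < 1/2}` (`BCSData.compl_outerB_eq`), and
   **`X ∖ h₁ {‖w‖ < 1/2}` is a strong deformation retract of `X`** (§2–§3): inside the half-disc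
   use the radial projection `ρ` of the closed half-ball `{‖w‖ ≤ 1/2}` from the south pole `-e₀/2`
   onto the hemisphere `{‖w‖ = 1/2, w₀ ≥ 0}` (`Literature.Topology.FourManifolds.spp`; it fixes `{‖w‖ ≥ 1/2}`), transported by
   `h₁` and extended by the identity, together with the straight-line homotopy to the identity
   (`Literature.Topology.FourManifolds.complRetr`, `Literature.Topology.FourManifolds.homotopyEquivComplHalfBall`). Hence `X'` is contractible; likewise `Y'`
   (by the symmetry `BCSData.symm`, `boundaryConnectedSumRel_swap`).
2. The hemisphere `S` is contractible (`Literature.Topology.FourManifolds.contractibleSpace_unitHalfSphere`: normalise the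
   segment to the pole `e₀`).
3. Conclude by the collared-cover theorem `Literature.AlgebraicTopology.Homotopy.CollaredCover.contractibleSpace`
   (`Literature/AlgebraicTopology/Homotopy/CollaredDeformationRetract.lean`: `Y'` deformation
   retracts onto the seam, so `P ≃ X'`).

## References

* A. Juhász, *Differential and Low-Dimensional Topology*, LMS Student Texts 104, CUP (2023),
  Def. 1.47 (boundary connected sum).
* A. A. Kosinski, *Differential Manifolds*, Academic Press (1993), Ch. VI §1 (connected sums:
  the same neck bookkeeping).
* A. Hatcher, *Algebraic Topology*, CUP (2002), Ch. 0 (deformation retractions, collars).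
* R. Matveyev, *A decomposition of smooth simply-connected h-cobordant 4-manifolds*,
  J. Differential Geom. 44 (1996), 571–582, proof of part 2 of the Theorem (fig. 2): the corks
  `W₁ ♮ W₂`.

## Design notes

* Everything is in namespace `Literature`; no named facts are introduced. The auxiliary structure
  `Literature.Topology.FourManifolds.BCSData` records the topological content of the hypotheses of the fact (half-discs as
  topological embeddings with open ranges, the two open embeddings of the punctured pieces, the
  identification); the smooth structures play no role.
* The unit hemisphere `Literature.unitHalfSphere n` (compact: the tree\'s
  `Literature.Topology.FourManifolds.HalfDiscPair.isCompact_unitHalfSphere`) parametrises the seam; its pole is the tree\'s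
  `Literature.Topology.FourManifolds.HalfDiscPair.unitVec`.
-/

open Set Function Topology
open scoped unitInterval Topology Manifold ContDiff RealInnerProductSpace

noncomputable section

namespace Literature.Topology.FourManifolds

universe u

attribute [local instance] Classical.propDecidable

/-- Local notation: `𝔼 n` is the model Euclidean space `EuclideanSpace ℝ (Fin n)`. -/
local notation "𝔼 " n:arg => EuclideanSpace ℝ (Fin n)

/-! ### §1 Half-balls, the unit hemisphere -/

section HalfSpace

variable {n : ℕ} [NeZero n]

/-- The closed half-ball `{v ∈ ℝⁿ₊ | ‖v‖ ≤ r}` of the closed half space is compact. [folklore] -/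
theorem isCompact_closedHalfBall (r : ℝ) : IsCompact {v : EuclideanHalfSpace n | ‖v.val‖ ≤ r} := by
  have hcl : IsClosed {y : 𝔼 n | 0 ≤ y 0} :=
    range_modelWithCornersEuclideanHalfSpace n ▸ (𝓡∂ n).isClosed_range
  have hce : IsClosedEmbedding (Subtype.val : EuclideanHalfSpace n → 𝔼 n) :=
    hcl.isClosedEmbedding_subtypeVal
  have hset : {v : EuclideanHalfSpace n | ‖v.val‖ ≤ r} =
      (Subtype.val : EuclideanHalfSpace n → 𝔼 n) ⁻¹' Metric.closedBall (0 : 𝔼 n) r := by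
    ext v
    exact mem_closedBall_zero_iff.symm
  rw [hset]
  exact hce.isCompact_preimage (isCompact_closedBall 0 r)

/-- The image of a closed half-ball under a continuous map into a Hausdorff space is closed.
[folklore] -/
theorem isClosed_image_closedHalfBall {X : Type*} [TopologicalSpace X] [T2Space X]
    {h : EuclideanHalfSpace n → X} (hc : Continuous h) (r : ℝ) :
    IsClosed (h '' {v : EuclideanHalfSpace n | ‖v.val‖ ≤ r}) :=
  ((isCompact_closedHalfBall r).image hc).isClosed

/-- A nonzero vector of the closed half space is `dilate t v` for a unit vector `v` and
`t = ‖w‖ > 0`. [cite: Juhasz2023, Def. 1.47] -/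
theorem EuclideanHalfSpace.exists_eq_dilate {w : EuclideanHalfSpace n} (hw : w ≠ 0) :
    ∃ (v : EuclideanHalfSpace n), ‖v.val‖ = 1 ∧ 0 < ‖w.val‖ ∧
      w = EuclideanHalfSpace.dilate ‖w.val‖ v := by
  set t : ℝ := ‖w.val‖ with ht
  have ht0 : 0 < t := by
    rw [ht, norm_pos_iff]
    exact fun h => hw (EuclideanHalfSpace.ext _ _ h)
  refine ⟨EuclideanHalfSpace.dilate t⁻¹ w, ?_, ht0, ?_⟩
  · rw [EuclideanHalfSpace.val_dilate_of_nonneg (inv_nonneg.2 ht0.le), norm_smul,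
      Real.norm_of_nonneg (inv_nonneg.2 ht0.le), ← ht, inv_mul_cancel₀ ht0.ne']
  · rw [EuclideanHalfSpace.dilate_dilate ht0.le (inv_nonneg.2 ht0.le), mul_inv_cancel₀ ht0.ne',
      EuclideanHalfSpace.dilate_one]

/-- For an injective `h`, a unit vector `v` and `t ≥ 0`: `h (t • v)` lies in the image of the
closed half-ball of radius `r` iff `t ≤ r`. [folklore] -/
theorem dilate_mem_image_closedHalfBall_iff {X : Type*} {h : EuclideanHalfSpace n → X}
    (hi : Injective h) {v : EuclideanHalfSpace n} (hv : ‖v.val‖ = 1) {t : ℝ} (ht : 0 ≤ t) (r : ℝ) :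
    h (EuclideanHalfSpace.dilate t v) ∈ h '' {w : EuclideanHalfSpace n | ‖w.val‖ ≤ r} ↔ t ≤ r := by
  constructor
  · rintro ⟨w, hw, hwv⟩
    rw [hi hwv, mem_setOf_eq, EuclideanHalfSpace.norm_val_dilate ht hv] at hw
    exact hw
  · intro htr
    exact ⟨_, by rwa [mem_setOf_eq, EuclideanHalfSpace.norm_val_dilate ht hv], rfl⟩

/-- For an injective `h`, a unit vector `v` and `t ≥ 0`: `h (t • v)` lies in the image of the
open half-ball of radius `r` iff `t < r`. [folklore] -/
theorem dilate_mem_image_halfBall_iff {X : Type*} {h : EuclideanHalfSpace n → X}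
    (hi : Injective h) {v : EuclideanHalfSpace n} (hv : ‖v.val‖ = 1) {t : ℝ} (ht : 0 ≤ t) (r : ℝ) :
    h (EuclideanHalfSpace.dilate t v) ∈ h '' {w : EuclideanHalfSpace n | ‖w.val‖ < r} ↔ t < r := by
  constructor
  · rintro ⟨w, hw, hwv⟩
    rw [hi hwv, mem_setOf_eq, EuclideanHalfSpace.norm_val_dilate ht hv] at hw
    exact hw
  · intro htr
    exact ⟨_, by rwa [mem_setOf_eq, EuclideanHalfSpace.norm_val_dilate ht hv], rfl⟩

/-- Dilation is jointly continuous. [cite: Juhasz2023, Def. 1.47] -/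
theorem EuclideanHalfSpace.continuous_uncurry_dilate : Continuous fun p : ℝ × EuclideanHalfSpace n =>
    EuclideanHalfSpace.dilate p.1 p.2 :=
  continuous_induced_rng.2 ((continuous_fst.max continuous_const).smul
    (continuous_subtype_val.comp continuous_snd))

variable (n) in
/-- The unit hemisphere `{v ∈ ℝⁿ₊ | ‖v‖ = 1}` of the closed half space (the directions of the
half-discs; it parametrises the seam `∂X # ∂Y ⊃ Sⁿ⁻¹₊` of a boundary connected sum). [cite: Juhasz2023, Def. 1.47] -/
def unitHalfSphere : Set (EuclideanHalfSpace n) := {v | ‖v.val‖ = 1}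

/-- Membership in the unit hemisphere. [cite: Juhasz2023, Def. 1.47] -/
@[simp] theorem mem_unitHalfSphere {v : EuclideanHalfSpace n} : v ∈ unitHalfSphere n ↔ ‖v.val‖ = 1 :=
  Iff.rfl

/-- The unit hemisphere is compact. [folklore] -/
theorem isCompact_unitHalfSphere' : IsCompact (unitHalfSphere n) :=
  HalfDiscPair.isCompact_unitHalfSphere

/-- The unit hemisphere is a compact space. [folklore] -/
instance instCompactSpaceUnitHalfSphere : CompactSpace (unitHalfSphere n) :=
  isCompact_iff_compactSpace.1 isCompact_unitHalfSphere'

/-- The pole `e₀ = (1, 0, …, 0)` of the unit hemisphere. [folklore] -/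
def hemispherePole : unitHalfSphere n :=
  ⟨HalfDiscPair.unitVec, by simp [unitHalfSphere, HalfDiscPair.unitVec]⟩

/-- The segment from a point of the hemisphere to the pole avoids the origin: the vector
`(1 - t) v + t e₀` is nonzero for `v` in the closed half space with `‖v‖ = 1` and `t ∈ [0, 1]`.
[folklore] -/
theorem toHemispherePole_ne_zero (v : unitHalfSphere n) (t : I) :
    (1 - (t : ℝ)) • (v : EuclideanHalfSpace n).val + (t : ℝ) • (HalfDiscPair.unitVec (n := n)).val ≠ 0 := by
  intro h
  have h0 := congrArg (fun x : 𝔼 n => x 0) h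
  simp only [PiLp.add_apply, PiLp.smul_apply, smul_eq_mul, PiLp.zero_apply] at h0
  have he : (HalfDiscPair.unitVec (n := n)).val 0 = 1 := by simp [HalfDiscPair.unitVec]
  rw [he, mul_one] at h0
  have hv0 : 0 ≤ (v : EuclideanHalfSpace n).val 0 := (v : EuclideanHalfSpace n).2
  have ht0 : (t : ℝ) = 0 := by nlinarith [t.2.1, t.2.2, mul_nonneg (sub_nonneg.2 t.2.2) hv0]
  rw [ht0, sub_zero, one_smul, zero_smul, add_zero] at h
  have := v.2
  rw [mem_unitHalfSphere, h, norm_zero] at this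
  exact zero_ne_one this

/-- **The unit hemisphere is contractible**: normalising the segment to the pole,
`(t, v) ↦ ((1 - t) v + t e₀) / ‖(1 - t) v + t e₀‖`, contracts it to `e₀` (it is a geodesically
star-shaped cap; equivalently it is homeomorphic to the closed disc `Dⁿ⁻¹`). [folklore] -/
theorem contractibleSpace_unitHalfSphere : ContractibleSpace (unitHalfSphere n) := by
  rw [contractible_iff_id_nullhomotopic]
  -- the normalised segment
  let w : I × unitHalfSphere n → 𝔼 n := fun p =>
    (1 - (p.1 : ℝ)) • (p.2 : EuclideanHalfSpace n).val + (p.1 : ℝ) • (HalfDiscPair.unitVec (n := n)).val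
  have hw : Continuous w :=
    ((continuous_const.sub (continuous_subtype_val.comp continuous_fst)).smul
      (continuous_subtype_val.comp (continuous_subtype_val.comp continuous_snd))).add
      ((continuous_subtype_val.comp continuous_fst).smul continuous_const)
  have hw0 : ∀ p, w p ≠ 0 := fun p => toHemispherePole_ne_zero p.2 p.1
  have hwpos : ∀ p, 0 ≤ w p 0 := fun p => by
    simp only [w, PiLp.add_apply, PiLp.smul_apply, smul_eq_mul]
    have he : (HalfDiscPair.unitVec (n := n)).val 0 = 1 := by simp [HalfDiscPair.unitVec]
    rw [he, mul_one]
    exact add_nonneg (mul_nonneg (sub_nonneg.2 p.1.2.2) (p.2 : EuclideanHalfSpace n).2) p.1.2.1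
  let F : I × unitHalfSphere n → unitHalfSphere n := fun p =>
    ⟨⟨‖w p‖⁻¹ • w p, by
      show 0 ≤ (‖w p‖⁻¹ • w p) 0
      rw [PiLp.smul_apply, smul_eq_mul]
      exact mul_nonneg (inv_nonneg.2 (norm_nonneg _)) (hwpos p)⟩, by
      show ‖‖w p‖⁻¹ • w p‖ = 1
      rw [norm_smul, norm_inv, norm_norm, inv_mul_cancel₀ (norm_ne_zero_iff.2 (hw0 p))]⟩
  have hF : Continuous F := by
    refine Continuous.subtype_mk (Continuous.subtype_mk ?_ _) _
    exact ((continuous_norm.comp hw).inv₀ fun p => norm_ne_zero_iff.2 (hw0 p)).smul hw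
  have h0 : ∀ v, F (0, v) = v := fun v => by
    apply Subtype.ext; apply Subtype.ext
    show ‖w (0, v)‖⁻¹ • w (0, v) = (v : EuclideanHalfSpace n).val
    have : w (0, v) = (v : EuclideanHalfSpace n).val := by
      simp [w]
    rw [this, (mem_unitHalfSphere.1 v.2), inv_one, one_smul]
  have h1 : ∀ v, F (1, v) = hemispherePole := fun v => by
    apply Subtype.ext; apply Subtype.ext
    show ‖w (1, v)‖⁻¹ • w (1, v) = (HalfDiscPair.unitVec (n := n)).val
    have : w (1, v) = (HalfDiscPair.unitVec (n := n)).val := by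
      simp [w]
    have he1 : ‖(HalfDiscPair.unitVec (n := n)).val‖ = 1 := (hemispherePole (n := n)).2
    rw [this, he1, inv_one, one_smul]
  refine ⟨hemispherePole, ⟨?_⟩⟩
  exact
    { toFun := F
      continuous_toFun := hF
      map_zero_left := h0
      map_one_left := h1 }

end HalfSpace

/-! ### §2 The radial projection from the south pole: `ℝⁿ₊` retracts onto `{‖v‖ ≥ 1/2}` -/

section SouthPole

variable {n : ℕ} [NeZero n]

/-- `‖e₀‖ = 1` for the pole vector `e₀ = unitVec`. [folklore] -/
theorem norm_val_unitVec : ‖(HalfDiscPair.unitVec (n := n)).val‖ = 1 := (hemispherePole (n := n)).2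

/-- `e₀ 0 = 1`. [folklore] -/
@[simp] theorem val_unitVec_apply_zero : (HalfDiscPair.unitVec (n := n)).val 0 = 1 := by
  simp [HalfDiscPair.unitVec]

/-- `⟪v, e₀⟫ = v 0`. [folklore] -/
theorem inner_val_unitVec (v : EuclideanHalfSpace n) :
    inner ℝ v.val (HalfDiscPair.unitVec (n := n)).val = v.val 0 := by
  simp [HalfDiscPair.unitVec, EuclideanSpace.inner_single_right]

/-- The parameter `μ(v) = (1/2 + v₀) / (‖v‖² + v₀ + 1/4)` at which the ray from the south pole
`-e₀/2` through `v` meets the sphere of radius `1/2`. [folklore] -/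
def sppMu (v : EuclideanHalfSpace n) : ℝ := (1 / 2 + v.val 0) / (‖v.val‖ ^ 2 + v.val 0 + 1 / 4)

/-- The denominator of `μ` is positive on the closed half space. [folklore] -/
theorem sppMu_den_pos (v : EuclideanHalfSpace n) : 0 < ‖v.val‖ ^ 2 + v.val 0 + 1 / 4 := by
  have := v.2
  nlinarith [sq_nonneg ‖v.val‖]

/-- `μ` is continuous. [folklore] -/
theorem continuous_sppMu : Continuous (sppMu (n := n)) := by
  have h0 : Continuous fun v : EuclideanHalfSpace n => v.val 0 :=
    (EuclideanSpace.proj (0 : Fin n)).continuous.comp continuous_subtype_val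
  refine (continuous_const.add h0).div (((continuous_norm.comp continuous_subtype_val).pow 2).add
    h0 |>.add continuous_const) fun v => (sppMu_den_pos v).ne'

/-- `μ · (‖v‖² + v₀ + 1/4) = 1/2 + v₀`. [folklore] -/
theorem sppMu_mul_den (v : EuclideanHalfSpace n) :
    sppMu v * (‖v.val‖ ^ 2 + v.val 0 + 1 / 4) = 1 / 2 + v.val 0 :=
  div_mul_cancel₀ _ (sppMu_den_pos v).ne'

/-- `μ v ≤ 1` when `‖v‖ ≥ 1/2`. [folklore] -/
theorem sppMu_le_one {v : EuclideanHalfSpace n} (hv : 1 / 2 ≤ ‖v.val‖) : sppMu v ≤ 1 := by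
  rw [sppMu, div_le_one (sppMu_den_pos v)]
  nlinarith

/-- `1 ≤ μ v` when `‖v‖ ≤ 1/2`. [folklore] -/
theorem one_le_sppMu {v : EuclideanHalfSpace n} (hv : ‖v.val‖ ≤ 1 / 2) : 1 ≤ sppMu v := by
  rw [sppMu, one_le_div (sppMu_den_pos v)]
  nlinarith [norm_nonneg v.val]

/-- The coefficient `max (μ v) 1` (`= μ v` on the half-ball of radius `1/2`, `= 1` outside).
[folklore] -/
def sppCoef (v : EuclideanHalfSpace n) : ℝ := max (sppMu v) 1

/-- `1 ≤ sppCoef v`. [folklore] -/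
theorem one_le_sppCoef (v : EuclideanHalfSpace n) : 1 ≤ sppCoef v := le_max_right _ _

/-- `sppCoef` is continuous. [folklore] -/
theorem continuous_sppCoef : Continuous (sppCoef (n := n)) := continuous_sppMu.max continuous_const

/-- **The radial projection from the south pole** (as a vector):
`-e₀/2 + c (v + e₀/2) = c v + ((c - 1)/2) e₀` with `c = max (μ v) 1`. [folklore] -/
def sppVal (v : EuclideanHalfSpace n) : 𝔼 n :=
  sppCoef v • v.val + ((sppCoef v - 1) / 2) • (HalfDiscPair.unitVec (n := n)).val

/-- The projection stays in the closed half space. [folklore] -/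
theorem sppVal_apply_zero_nonneg (v : EuclideanHalfSpace n) : 0 ≤ sppVal v 0 := by
  simp only [sppVal, PiLp.add_apply, PiLp.smul_apply, smul_eq_mul, val_unitVec_apply_zero, mul_one]
  have h1 := one_le_sppCoef v
  have h2 := v.2
  nlinarith

/-- **The radial projection from the south pole** `ρ : ℝⁿ₊ → ℝⁿ₊`: it maps the closed half-ball
of radius `1/2` onto the hemisphere of radius `1/2` and is the identity outside that half-ball.
[folklore] -/
def spp (v : EuclideanHalfSpace n) : EuclideanHalfSpace n := ⟨sppVal v, sppVal_apply_zero_nonneg v⟩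

/-- Unfolding of `spp`. [folklore] -/
theorem val_spp (v : EuclideanHalfSpace n) : (spp v).val = sppVal v := rfl

/-- `ρ` is continuous. [folklore] -/
theorem continuous_spp : Continuous (spp (n := n)) := by
  refine Continuous.subtype_mk ?_ _
  exact (continuous_sppCoef.smul continuous_subtype_val).add
    (((continuous_sppCoef.sub continuous_const).div_const 2).smul continuous_const)

/-- `ρ v = v` for `‖v‖ ≥ 1/2`. [folklore] -/
theorem spp_of_half_le {v : EuclideanHalfSpace n} (hv : 1 / 2 ≤ ‖v.val‖) : spp v = v := by
  apply EuclideanHalfSpace.ext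
  have hc : sppCoef v = 1 := max_eq_right (sppMu_le_one hv)
  rw [val_spp, sppVal, hc]
  simp

/-- `‖ρ v‖ = 1/2` for `‖v‖ ≤ 1/2` (the point of the construction). [folklore] -/
theorem norm_spp_of_le_half {v : EuclideanHalfSpace n} (hv : ‖v.val‖ ≤ 1 / 2) :
    ‖(spp v).val‖ = 1 / 2 := by
  have hμ := one_le_sppMu hv
  have hc : sppCoef v = sppMu v := max_eq_left hμ
  set μ := sppMu v with hμdef
  have hden := sppMu_mul_den v
  rw [← hμdef] at hden
  have hsq : ‖(spp v).val‖ ^ 2 = (1 / 2) ^ 2 := by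
    rw [val_spp, sppVal, hc, norm_add_sq_real, norm_smul, norm_smul, real_inner_smul_left,
      real_inner_smul_right, inner_val_unitVec, norm_val_unitVec, mul_one, Real.norm_eq_abs,
      Real.norm_eq_abs, mul_pow, sq_abs, sq_abs]
    linear_combination μ * hden
  exact (sq_eq_sq₀ (norm_nonneg _) (by norm_num)).1 hsq

/-- `1/2 ≤ ‖ρ v‖` for every `v`. [folklore] -/
theorem half_le_norm_spp (v : EuclideanHalfSpace n) : 1 / 2 ≤ ‖(spp v).val‖ := by
  by_cases hv : ‖v.val‖ ≤ 1 / 2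
  · rw [norm_spp_of_le_half hv]
  · rw [spp_of_half_le (le_of_lt (not_le.1 hv))]
    exact le_of_lt (not_le.1 hv)

/-- **The straight path from `ρ v` back to `v`** inside the (convex) closed half space:
`(1 - t) ρ v + t v`. [folklore] -/
def sppPath (t : I) (v : EuclideanHalfSpace n) : EuclideanHalfSpace n :=
  ⟨(1 - (t : ℝ)) • (spp v).val + (t : ℝ) • v.val, by
    show 0 ≤ ((1 - (t : ℝ)) • (spp v).val + (t : ℝ) • v.val) 0
    simp only [PiLp.add_apply, PiLp.smul_apply, smul_eq_mul]
    exact add_nonneg (mul_nonneg (sub_nonneg.2 t.2.2) (spp v).2) (mul_nonneg t.2.1 v.2)⟩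

/-- The path is jointly continuous. [folklore] -/
theorem continuous_sppPath : Continuous fun p : I × EuclideanHalfSpace n => sppPath p.1 p.2 := by
  refine Continuous.subtype_mk ?_ _
  exact ((continuous_const.sub (continuous_subtype_val.comp continuous_fst)).smul
    (continuous_subtype_val.comp (continuous_spp.comp continuous_snd))).add
    ((continuous_subtype_val.comp continuous_fst).smul (continuous_subtype_val.comp continuous_snd))

/-- At `t = 0` the path is at `ρ v`. [folklore] -/
@[simp] theorem sppPath_zero (v : EuclideanHalfSpace n) : sppPath 0 v = spp v :=
  EuclideanHalfSpace.ext _ _ (by simp [sppPath])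

/-- At `t = 1` the path is at `v`. [folklore] -/
@[simp] theorem sppPath_one (v : EuclideanHalfSpace n) : sppPath 1 v = v :=
  EuclideanHalfSpace.ext _ _ (by simp [sppPath])

/-- The path is constant at `v` when `‖v‖ ≥ 1/2`. [folklore] -/
theorem sppPath_of_half_le {v : EuclideanHalfSpace n} (hv : 1 / 2 ≤ ‖v.val‖) (t : I) :
    sppPath t v = v :=
  EuclideanHalfSpace.ext _ _ (by
    show (1 - (t : ℝ)) • (spp v).val + (t : ℝ) • v.val = v.val
    rw [spp_of_half_le hv, ← add_smul, sub_add_cancel, one_smul])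

end SouthPole

/-! ### §3 A manifold minus an open half-ball at the boundary is a deformation retract -/

section ComplHalfBall

variable {n : ℕ} [NeZero n] {X : Type u} [TopologicalSpace X] {h : EuclideanHalfSpace n → X}

/-- A total inverse of a half-disc `h` (junk `0` off its range). [folklore] -/
def hdInv (he : IsEmbedding h) (x : X) : EuclideanHalfSpace n :=
  if hx : x ∈ range h then he.toHomeomorph.symm ⟨x, hx⟩ else 0

/-- `hdInv ∘ h = id`. [folklore] -/
@[simp] theorem hdInv_apply (he : IsEmbedding h) (v : EuclideanHalfSpace n) : hdInv he (h v) = v := by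
  rw [hdInv, dif_pos (mem_range_self v)]
  exact he.toHomeomorph_symm_apply v

/-- `hdInv` is continuous on the range of `h`. [folklore] -/
theorem continuousOn_hdInv (he : IsEmbedding h) : ContinuousOn (hdInv he) (range h) := by
  rw [continuousOn_iff_continuous_restrict]
  have hr : (range h).restrict (hdInv he) = he.toHomeomorph.symm := by
    funext ⟨x, hx⟩
    simp only [restrict_apply, hdInv, dif_pos hx]
  rw [hr]
  exact Homeomorph.continuous _

/-- **The deformation of `X` pushing the half-ball `h {‖v‖ < 1/2}` out to the hemisphere**:
`h ∘ (path of ρ) ∘ h⁻¹` on the range of `h`, the identity elsewhere; time `0` is the retraction,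
time `1` the identity. [folklore] -/
def complRetr (he : IsEmbedding h) (t : I) (x : X) : X :=
  if x ∈ range h then h (sppPath t (hdInv he x)) else x

/-- On the half-disc the deformation is `h ∘ path ∘ h⁻¹`. [folklore] -/
theorem complRetr_apply (he : IsEmbedding h) (t : I) (v : EuclideanHalfSpace n) :
    complRetr he t (h v) = h (sppPath t v) := by
  rw [complRetr, if_pos (mem_range_self v), hdInv_apply]

/-- Off the half-disc the deformation is the identity. [folklore] -/
theorem complRetr_of_not_mem (he : IsEmbedding h) (t : I) {x : X} (hx : x ∉ range h) :
    complRetr he t x = x := by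
  rw [complRetr, if_neg hx]

/-- At time `1` the deformation is the identity. [folklore] -/
theorem complRetr_one (he : IsEmbedding h) (x : X) : complRetr he 1 x = x := by
  by_cases hx : x ∈ range h
  · obtain ⟨v, rfl⟩ := hx
    rw [complRetr_apply, sppPath_one]
  · exact complRetr_of_not_mem he 1 hx

/-- The deformation fixes the complement of the open half-ball `h {‖v‖ < 1/2}` pointwise.
[folklore] -/
theorem complRetr_of_mem_compl (he : IsEmbedding h) (t : I) {x : X}
    (hx : x ∈ (h '' {v : EuclideanHalfSpace n | ‖v.val‖ < 1 / 2})ᶜ) : complRetr he t x = x := by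
  by_cases hx' : x ∈ range h
  · obtain ⟨v, rfl⟩ := hx'
    have hv : 1 / 2 ≤ ‖v.val‖ := not_lt.1 fun hlt => hx ⟨v, hlt, rfl⟩
    rw [complRetr_apply, sppPath_of_half_le hv]
  · exact complRetr_of_not_mem he t hx'

/-- At time `0` the deformation lands in the complement of the open half-ball. [folklore] -/
theorem complRetr_zero_mem (he : IsEmbedding h) (x : X) :
    complRetr he 0 x ∈ (h '' {v : EuclideanHalfSpace n | ‖v.val‖ < 1 / 2})ᶜ := by
  by_cases hx : x ∈ range h
  · obtain ⟨v, rfl⟩ := hx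
    rw [complRetr_apply, sppPath_zero]
    rintro ⟨w, hw, hwv⟩
    rw [he.injective hwv, mem_setOf_eq] at hw
    linarith [half_le_norm_spp v]
  · rw [complRetr_of_not_mem he 0 hx]
    exact fun ⟨w, _, hwx⟩ => hx ⟨w, hwx⟩

/-- **The deformation is jointly continuous** (`X` Hausdorff, `h` with open range): near the
range of `h` it is `h ∘ path ∘ h⁻¹`; off the compact set `h {‖v‖ ≤ 1/2}` it is the identity.
[folklore] -/
theorem continuous_complRetr [T2Space X] (he : IsEmbedding h) (ho : IsOpen (range h)) :
    Continuous fun p : I × X => complRetr he p.1 p.2 := by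
  rw [continuous_iff_continuousAt]
  rintro ⟨t, x⟩
  by_cases hx : x ∈ range h
  · have hU : (univ : Set I) ×ˢ range h ∈ 𝓝 (t, x) :=
      (isOpen_univ.prod ho).mem_nhds ⟨mem_univ _, hx⟩
    have h2 : ContinuousOn (fun p : I × X => hdInv he p.2) ((univ : Set I) ×ˢ range h) :=
      (continuousOn_hdInv he).comp continuous_snd.continuousOn fun p hp => hp.2
    have h3 : Continuous fun q : I × EuclideanHalfSpace n => h (sppPath q.1 q.2) :=
      he.continuous.comp continuous_sppPath
    have h4 : ContinuousOn (fun p : I × X => (p.1, hdInv he p.2)) ((univ : Set I) ×ˢ range h) :=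
      continuous_fst.continuousOn.prodMk h2
    -- (kept in `∘` form: unifying the composite with its `fun`-form is expensive)
    have hc : ContinuousOn ((fun q : I × EuclideanHalfSpace n => h (sppPath q.1 q.2)) ∘
        (fun p : I × X => (p.1, hdInv he p.2))) ((univ : Set I) ×ˢ range h) :=
      h3.comp_continuousOn h4
    refine (hc.congr fun p hp => ?_).continuousAt hU
    obtain ⟨v, hv⟩ := hp.2
    show complRetr he p.1 p.2 = h (sppPath p.1 (hdInv he p.2))
    rw [← hv, complRetr_apply, hdInv_apply]
  · have hK : IsClosed (h '' {v : EuclideanHalfSpace n | ‖v.val‖ ≤ 1 / 2}) :=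
      isClosed_image_closedHalfBall he.continuous _
    have hV : (univ : Set I) ×ˢ (h '' {v : EuclideanHalfSpace n | ‖v.val‖ ≤ 1 / 2})ᶜ ∈ 𝓝 (t, x) :=
      (isOpen_univ.prod hK.isOpen_compl).mem_nhds ⟨mem_univ _, fun ⟨w, _, hwx⟩ => hx ⟨w, hwx⟩⟩
    refine (continuousOn_snd.congr fun p hp => ?_).continuousAt hV
    exact complRetr_of_mem_compl he p.1 fun ⟨w, hw, hwp⟩ =>
      hp.2 ⟨w, show ‖w.val‖ ≤ 1 / 2 from le_of_lt hw, hwp⟩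

/-- **`X` minus the open half-ball `h {‖v‖ < 1/2}` is homotopy equivalent to `X`** (it is a
strong deformation retract). [folklore] -/
def homotopyEquivComplHalfBall [T2Space X] (he : IsEmbedding h) (ho : IsOpen (range h)) :
    ContinuousMap.HomotopyEquiv ↥((h '' {v : EuclideanHalfSpace n | ‖v.val‖ < 1 / 2})ᶜ) X where
  toFun := ⟨Subtype.val, continuous_subtype_val⟩
  invFun := ⟨fun x => ⟨complRetr he 0 x, complRetr_zero_mem he x⟩,
    ((continuous_complRetr he ho).comp (Continuous.prodMk_right 0)).subtype_mk _⟩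
  left_inv := by
    have hid : (⟨fun x => ⟨complRetr he 0 x, complRetr_zero_mem he x⟩,
        ((continuous_complRetr he ho).comp (Continuous.prodMk_right 0)).subtype_mk _⟩ :
          C(X, ↥((h '' {v : EuclideanHalfSpace n | ‖v.val‖ < 1 / 2})ᶜ))).comp
        ⟨Subtype.val, continuous_subtype_val⟩ = ContinuousMap.id _ := by
      ext x
      exact complRetr_of_mem_compl he 0 x.2
    rw [hid]
  right_inv := ⟨{ toFun := fun p => complRetr he p.1 p.2
                  continuous_toFun := continuous_complRetr he ho
                  map_zero_left := fun x => rfl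
                  map_one_left := fun x => complRetr_one he x }⟩

/-- **`X` minus an open half-ball at the boundary is contractible when `X` is.** [folklore] -/
theorem contractibleSpace_compl_image_halfBall [T2Space X] [ContractibleSpace X]
    (he : IsEmbedding h) (ho : IsOpen (range h)) :
    ContractibleSpace ↥((h '' {v : EuclideanHalfSpace n | ‖v.val‖ < 1 / 2})ᶜ) :=
  (homotopyEquivComplHalfBall he ho).contractibleSpace

end ComplHalfBall

/-! ### §4 The topological data of a boundary connected sum and its collared cover -/

section BCS

variable {n : ℕ} [NeZero n] {X Y P : Type u} [TopologicalSpace X] [T2Space X] [TopologicalSpace Y]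
  [T2Space Y] [TopologicalSpace P]

variable (n X Y P) in
/-- **The topological data of a boundary connected sum** `P = X ♮ Y`: half-discs `h₁`, `h₂`
(topological embeddings of the closed half space with open ranges) and the open embeddings
`jA : X ∖ {h₁ 0} → P`, `jB : Y ∖ {h₂ 0} → P` of an open gluing along
`boundaryConnectedSumRel h₁ h₂` — exactly what the hypotheses of
`Literature.Topology.FourManifolds.contractibleSpace_of_isOpenGluing_boundaryConnectedSumRel` provide, smoothness forgotten.
[cite: Juhasz2023, Def. 1.47] -/
structure BCSData where
  /-- The first half-disc. -/
  h₁ : EuclideanHalfSpace n → X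
  /-- The second half-disc. -/
  h₂ : EuclideanHalfSpace n → Y
  /-- `h₁` is a topological embedding. -/
  emb₁ : IsEmbedding h₁
  /-- `h₁` has open range. -/
  isOpen_range₁ : IsOpen (range h₁)
  /-- `h₂` is a topological embedding. -/
  emb₂ : IsEmbedding h₂
  /-- `h₂` has open range. -/
  isOpen_range₂ : IsOpen (range h₂)
  /-- The embedding of the first punctured piece. -/
  jA : puncture h₁ → P
  /-- The embedding of the second punctured piece. -/
  jB : puncture h₂ → P
  /-- `jA` is an open embedding. -/
  embA : IsOpenEmbedding jA
  /-- `jB` is an open embedding. -/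
  embB : IsOpenEmbedding jB
  /-- The two pieces cover `P`. -/
  union_range : range jA ∪ range jB = univ
  /-- Points are identified exactly along the boundary connected sum relation. -/
  rel_iff : ∀ a b, jA a = jB b ↔ boundaryConnectedSumRel h₁ h₂ a b

namespace BCSData

variable (D : BCSData n X Y P)

/-- The same data with the roles of `X` and `Y` exchanged (`boundaryConnectedSumRel_swap`).
[cite: Juhasz2023, Def. 1.47] -/
def symm : BCSData n Y X P where
  h₁ := D.h₂
  h₂ := D.h₁
  emb₁ := D.emb₂
  isOpen_range₁ := D.isOpen_range₂
  emb₂ := D.emb₁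
  isOpen_range₂ := D.isOpen_range₁
  jA := D.jB
  jB := D.jA
  embA := D.embB
  embB := D.embA
  union_range := by rw [union_comm]; exact D.union_range
  rel_iff b a := by rw [eq_comm, D.rel_iff a b, ← boundaryConnectedSumRel_swap]

/-! #### Points on the first half-disc -/

/-- `h₁ (t • v) ≠ h₁ 0` for a unit vector `v` and `t > 0`. [folklore] -/
theorem h₁_dilate_ne (v : unitHalfSphere n) {t : ℝ} (ht : 0 < t) :
    D.h₁ (EuclideanHalfSpace.dilate t v) ≠ D.h₁ 0 := fun h =>
  EuclideanHalfSpace.dilate_ne_zero ht v.2 (D.emb₁.injective h)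

/-- `h₂ (t • v) ≠ h₂ 0` for a unit vector `v` and `t > 0`. [folklore] -/
theorem h₂_dilate_ne (v : unitHalfSphere n) {t : ℝ} (ht : 0 < t) :
    D.h₂ (EuclideanHalfSpace.dilate t v) ≠ D.h₂ 0 := fun h =>
  EuclideanHalfSpace.dilate_ne_zero ht v.2 (D.emb₂.injective h)

/-- The point `h₁ (t • v)` of the first punctured piece (`v` a unit vector, `t > 0`).
[cite: Juhasz2023, Def. 1.47] -/
def discPtA (v : unitHalfSphere n) {t : ℝ} (ht : 0 < t) : puncture D.h₁ :=
  ⟨D.h₁ (EuclideanHalfSpace.dilate t v), D.h₁_dilate_ne v ht⟩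

/-- The point `h₂ (t • v)` of the second punctured piece. [cite: Juhasz2023, Def. 1.47] -/
def discPtB (v : unitHalfSphere n) {t : ℝ} (ht : 0 < t) : puncture D.h₂ :=
  ⟨D.h₂ (EuclideanHalfSpace.dilate t v), D.h₂_dilate_ne v ht⟩

/-- **The identification**: `jA (h₁ (t • v)) = jB (h₂ ((1 - t) • v))` for `0 < t < 1`.
[cite: Juhasz2023, Def. 1.47] -/
theorem jA_discPtA_eq (v : unitHalfSphere n) {t : ℝ} (ht0 : 0 < t) (ht1 : t < 1) :
    D.jA (D.discPtA v ht0) = D.jB (D.discPtB v (sub_pos.2 ht1)) :=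
  (D.rel_iff _ _).2 ⟨v, t, v.2, ⟨ht0, ht1⟩, rfl, rfl⟩

/-- A point of the first punctured piece lying in the image of a half-ball is `h₁ (t • v)` with
`v` a unit vector and `t = ‖·‖ > 0`. [folklore] -/
theorem exists_eq_discPtA {a : puncture D.h₁} {w : EuclideanHalfSpace n} (hwa : D.h₁ w = a) :
    ∃ (v : unitHalfSphere n) (ht : 0 < ‖w.val‖), a = D.discPtA v ht := by
  have hw0 : w ≠ 0 := by
    rintro rfl
    exact a.2 hwa.symm
  obtain ⟨v, hv, ht, hwv⟩ := EuclideanHalfSpace.exists_eq_dilate hw0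
  refine ⟨⟨v, hv⟩, ht, Subtype.ext ?_⟩
  show (a : X) = D.h₁ (EuclideanHalfSpace.dilate ‖w.val‖ v)
  rw [← hwa, ← hwv]

/-! #### The outer parts and the closed pieces -/

/-- The open set `jA (X ∖ h₁ {‖w‖ ≤ r})` of points of `P` far out in `X`. [folklore] -/
def outerA (r : ℝ) : Set P := D.jA '' {a | (a : X) ∉ D.h₁ '' {w : EuclideanHalfSpace n | ‖w.val‖ ≤ r}}

/-- The open set `jB (Y ∖ h₂ {‖w‖ ≤ r})` of points of `P` far out in `Y`. [folklore] -/
def outerB (r : ℝ) : Set P := D.jB '' {b | (b : Y) ∉ D.h₂ '' {w : EuclideanHalfSpace n | ‖w.val‖ ≤ r}}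

/-- `outerB` is `outerA` of the swapped data (definitional). [folklore] -/
theorem symm_outerA (r : ℝ) : D.symm.outerA r = D.outerB r := rfl

/-- `outerA` is `outerB` of the swapped data (definitional). [folklore] -/
theorem symm_outerB (r : ℝ) : D.symm.outerB r = D.outerA r := rfl

/-- `outerA r` is open (`X` Hausdorff: the image of the compact half-ball is closed, and `jA` is
an open map). [folklore] -/
theorem isOpen_outerA (r : ℝ) : IsOpen (D.outerA r) :=
  D.embA.isOpenMap _ ((isClosed_image_closedHalfBall D.emb₁.continuous r).isOpen_compl.preimage
    continuous_subtype_val)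

/-- `outerA` decreases with the radius. [folklore] -/
theorem outerA_mono {r r' : ℝ} (h : r ≤ r') : D.outerA r' ⊆ D.outerA r := by
  rintro _ ⟨a, ha, rfl⟩
  exact ⟨a, fun ⟨w, hw, hwa⟩ => ha ⟨w, le_trans (α := ℝ) hw h, hwa⟩, rfl⟩

/-- A point not far out in `Y` lies in the first piece: `P ∖ outerB (1/2) ⊆ range jA`.
[folklore] -/
theorem mem_range_jA_of_not_mem_outerB {p : P} (hp : p ∉ D.outerB (1 / 2)) : p ∈ range D.jA := by
  rcases (D.union_range.symm ▸ mem_univ p : p ∈ range D.jA ∪ range D.jB) with hA | ⟨b, rfl⟩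
  · exact hA
  · have hb : (b : Y) ∈ D.h₂ '' {w : EuclideanHalfSpace n | ‖w.val‖ ≤ 1 / 2} := by
      by_contra hb
      exact hp ⟨b, hb, rfl⟩
    obtain ⟨w, hw, hwb⟩ := hb
    obtain ⟨v, ht, rfl⟩ := D.symm.exists_eq_discPtA hwb
    have ht1 : ‖w.val‖ < 1 := lt_of_le_of_lt hw (by norm_num)
    -- `jB (h₂ (t v)) = jA (h₁ ((1 - t) v))`
    have h := D.symm.jA_discPtA_eq v ht ht1
    exact ⟨_, h.symm⟩

/-- **The seam.** A point of `P` neither far out in `X` nor far out in `Y` is a seam point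
`jA (h₁ (v/2))`. [folklore] -/
theorem exists_eq_of_not_mem {p : P} (hpB : p ∉ D.outerB (1 / 2)) (hpA : p ∉ D.outerA (1 / 2)) :
    ∃ v : unitHalfSphere n, D.jA (D.discPtA v one_half_pos) = p := by
  obtain ⟨a, rfl⟩ := D.mem_range_jA_of_not_mem_outerB hpB
  have ha : (a : X) ∈ D.h₁ '' {w : EuclideanHalfSpace n | ‖w.val‖ ≤ 1 / 2} := by
    by_contra ha
    exact hpA ⟨a, ha, rfl⟩
  obtain ⟨w, hw, hwa⟩ := ha
  obtain ⟨v, ht, rfl⟩ := D.exists_eq_discPtA hwa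
  have ht1 : ‖w.val‖ < 1 := lt_of_le_of_lt hw (by norm_num)
  have hAB := D.jA_discPtA_eq v ht ht1
  -- the partner in `Y` is not far out, so `1 - t ≤ 1/2`
  have hb : ((D.discPtB v (sub_pos.2 ht1) : puncture D.h₂) : Y) ∈
      D.h₂ '' {w : EuclideanHalfSpace n | ‖w.val‖ ≤ 1 / 2} := by
    by_contra hb
    exact hpB ⟨_, hb, hAB.symm⟩
  have h1t : 1 - ‖w.val‖ ≤ 1 / 2 :=
    (dilate_mem_image_closedHalfBall_iff D.emb₂.injective v.2 (sub_pos.2 ht1).le _).1 hb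
  have hteq : ‖w.val‖ = 1 / 2 := le_antisymm hw (by linarith)
  refine ⟨v, ?_⟩
  congr 1
  exact Subtype.ext (by simp [discPtA, hteq])

/-- The two outer parts are disjoint: a point far out in `X` is `h₁ (t v)` with `t > 1/2` at
best, and then its partner `h₂ ((1 - t) v)` is not far out in `Y`. [folklore] -/
theorem outerA_inter_outerB : D.outerA (1 / 2) ∩ D.outerB (1 / 2) = ∅ := by
  ext p
  simp only [mem_inter_iff, mem_empty_iff_false, iff_false, not_and]
  rintro ⟨a, ha, rfl⟩ ⟨b, hb, hab⟩
  obtain ⟨v, t, hv, ht, hta, htb⟩ := (D.rel_iff a b).1 hab.symm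
  have h1 : ¬ t ≤ 1 / 2 := fun h => ha ⟨_, by
    rw [mem_setOf_eq, EuclideanHalfSpace.norm_val_dilate ht.1.le hv]; exact h, hta.symm⟩
  have h2 : ¬ 1 - t ≤ 1 / 2 := fun h => hb ⟨_, by
    rw [mem_setOf_eq, EuclideanHalfSpace.norm_val_dilate (by linarith [ht.2]) hv]; exact h, htb.symm⟩
  exact h2 (by linarith [not_le.1 h1])

/-- **The closed `X`-side piece** `P ∖ outerB (1/2)` is `jA (X ∖ h₁ {‖w‖ < 1/2})`. [folklore] -/
theorem compl_outerB_eq :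
    (D.outerB (1 / 2))ᶜ =
      D.jA '' {a | (a : X) ∈ (D.h₁ '' {w : EuclideanHalfSpace n | ‖w.val‖ < 1 / 2})ᶜ} := by
  apply Subset.antisymm
  · intro p hp
    obtain ⟨a, rfl⟩ := D.mem_range_jA_of_not_mem_outerB hp
    refine ⟨a, ?_, rfl⟩
    rintro ⟨w, hw, hwa⟩
    obtain ⟨v, ht, rfl⟩ := D.exists_eq_discPtA hwa
    have hw' : ‖w.val‖ < 1 / 2 := hw
    have ht1 : ‖w.val‖ < 1 := by linarith
    have hAB := D.jA_discPtA_eq v ht ht1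
    refine hp ⟨_, ?_, hAB.symm⟩
    intro hb
    have := (dilate_mem_image_closedHalfBall_iff D.emb₂.injective v.2 (sub_pos.2 ht1).le _).1 hb
    linarith
  · rintro _ ⟨a, ha, rfl⟩ ⟨b, hb, hab⟩
    obtain ⟨v, t, hv, ht, hta, htb⟩ := (D.rel_iff a b).1 hab.symm
    have h1 : ¬ t < 1 / 2 := fun h => ha ⟨_, by
      rw [mem_setOf_eq, EuclideanHalfSpace.norm_val_dilate ht.1.le hv]; exact h, hta.symm⟩
    have h2 : ¬ 1 - t ≤ 1 / 2 := fun h => hb ⟨_, by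
      rw [mem_setOf_eq, EuclideanHalfSpace.norm_val_dilate (by linarith [ht.2]) hv]; exact h,
      htb.symm⟩
    exact h2 (by linarith [not_lt.1 h1])

/-- **The `X`-side piece is contractible** when `X` is (Hausdorff): it is homeomorphic to
`X ∖ h₁ {‖w‖ < 1/2}`, a deformation retract of `X`. [folklore] -/
theorem contractibleSpace_compl_outerB [ContractibleSpace X] :
    ContractibleSpace ↥(D.outerB (1 / 2))ᶜ := by
  rw [D.compl_outerB_eq]
  set S : Set (puncture D.h₁) :=
    {a | (a : X) ∈ (D.h₁ '' {w : EuclideanHalfSpace n | ‖w.val‖ < 1 / 2})ᶜ} with hS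
  haveI : ContractibleSpace ↥((D.h₁ '' {w : EuclideanHalfSpace n | ‖w.val‖ < 1 / 2})ᶜ) :=
    contractibleSpace_compl_image_halfBall D.emb₁ D.isOpen_range₁
  -- `S ≃ₜ X ∖ h₁ {‖w‖ < 1/2}`
  have hsub : ∀ x : X, x ∈ (D.h₁ '' {w : EuclideanHalfSpace n | ‖w.val‖ < 1 / 2})ᶜ →
      x ∈ (puncture D.h₁ : Set X) := by
    intro x hx h0
    refine hx ⟨0, ?_, (h0 : x = D.h₁ 0).symm⟩
    show ‖(0 : EuclideanHalfSpace n).val‖ < 1 / 2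
    rw [show (0 : EuclideanHalfSpace n).val = 0 from rfl, norm_zero]
    norm_num
  let e : ↥S ≃ₜ ↥((D.h₁ '' {w : EuclideanHalfSpace n | ‖w.val‖ < 1 / 2})ᶜ) :=
    { toFun := fun a => ⟨(a : puncture D.h₁), a.2⟩
      invFun := fun x => ⟨⟨x, hsub x x.2⟩, x.2⟩
      left_inv := fun a => rfl
      right_inv := fun x => rfl
      continuous_toFun := (continuous_subtype_val.comp continuous_subtype_val).subtype_mk _
      continuous_invFun := (continuous_subtype_val.subtype_mk _).subtype_mk _ }
  haveI : ContractibleSpace ↥S := e.contractibleSpace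
  exact (D.embA.isEmbedding.homeomorphImage S).symm.contractibleSpace

/-- **The `Y`-side piece is contractible** when `Y` is. [folklore] -/
theorem contractibleSpace_compl_outerA [ContractibleSpace Y] :
    ContractibleSpace ↥(D.outerA (1 / 2))ᶜ :=
  D.symm.contractibleSpace_compl_outerB

/-! #### The collar of the seam inside the `Y`-side piece -/

/-- The collar radius `c s = 1/2 - s/4 ∈ [1/4, 1/2]`. [folklore] -/
def cRad (s : I) : ℝ := 1 / 2 - (s : ℝ) / 4

/-- `c s > 0`. [folklore] -/
theorem cRad_pos (s : I) : 0 < cRad s := by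
  have := s.2.2; unfold cRad; linarith

/-- `c s ≤ 1/2`. [folklore] -/
theorem cRad_le_half (s : I) : cRad s ≤ 1 / 2 := by
  have := s.2.1; unfold cRad; linarith

/-- `1/4 ≤ c s`. [folklore] -/
theorem quarter_le_cRad (s : I) : 1 / 4 ≤ cRad s := by
  have := s.2.2; unfold cRad; linarith

/-- `1/4 < c s` for `s < 1`. [folklore] -/
theorem quarter_lt_cRad {s : I} (hs : s < 1) : 1 / 4 < cRad s := by
  have : (s : ℝ) < 1 := hs
  unfold cRad; linarith

/-- `c 0 = 1/2`. [folklore] -/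
@[simp] theorem cRad_zero : cRad 0 = 1 / 2 := by simp [cRad]

/-- **The collar** `κ (v, s) = jA (h₁ (c(s) • v))` of the seam, going into the `Y`-side piece
(`‖h₁`-coordinate`‖ = c s` decreasing from `1/2` to `1/4`). [folklore] -/
def collar (q : unitHalfSphere n × I) : P := D.jA (D.discPtA q.1 (cRad_pos q.2))

/-- The collar is continuous. [folklore] -/
theorem continuous_collar : Continuous D.collar := by
  refine D.embA.continuous.comp (Continuous.subtype_mk ?_ _)
  exact D.emb₁.continuous.comp (EuclideanHalfSpace.continuous_uncurry_dilate.comp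
    ((continuous_const.sub ((continuous_subtype_val.comp continuous_snd).div_const 4)).prodMk
      (continuous_subtype_val.comp continuous_fst)))

/-- The collar is injective. [folklore] -/
theorem collar_injective : Injective D.collar := by
  rintro ⟨v, s⟩ ⟨v', s'⟩ h
  have h1 := congrArg Subtype.val (D.embA.injective h)
  have h2 : EuclideanHalfSpace.dilate (cRad s) (v : EuclideanHalfSpace n) =
      EuclideanHalfSpace.dilate (cRad s') (v' : EuclideanHalfSpace n) := D.emb₁.injective h1
  have h3 := congrArg (fun w : EuclideanHalfSpace n => ‖w.val‖) h2
  simp only [EuclideanHalfSpace.norm_val_dilate (cRad_pos _).le v.2,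
    EuclideanHalfSpace.norm_val_dilate (cRad_pos _).le v'.2] at h3
  have hs : s = s' := Subtype.ext (by unfold cRad at h3; linarith)
  subst hs
  have h4 := congrArg Subtype.val h2
  rw [EuclideanHalfSpace.val_dilate_of_nonneg (cRad_pos s).le,
    EuclideanHalfSpace.val_dilate_of_nonneg (cRad_pos s).le] at h4
  have h5 := smul_right_injective (𝔼 n) (cRad_pos s).ne' h4
  exact Prod.ext (Subtype.ext (EuclideanHalfSpace.ext _ _ h5)) rfl

/-- The collar lies in the `Y`-side piece `P ∖ outerA (1/2)` (its `h₁`-radius is `≤ 1/2`).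
[folklore] -/
theorem collar_mem (q : unitHalfSphere n × I) : D.collar q ∈ (D.outerA (1 / 2))ᶜ := by
  rintro ⟨a, ha, heq⟩
  have ha' : a = D.discPtA q.1 (cRad_pos q.2) := D.embA.injective heq
  subst ha'
  exact ha ((dilate_mem_image_closedHalfBall_iff D.emb₁.injective q.1.2 (cRad_pos q.2).le _).2
    (cRad_le_half q.2))

/-- The bottom of the collar is the seam point `jA (h₁ (v/2))`. [folklore] -/
theorem collar_zero (v : unitHalfSphere n) : D.collar (v, 0) = D.jA (D.discPtA v one_half_pos) := by
  simp only [collar]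
  congr 1
  exact Subtype.ext (by simp [discPtA])

/-- The bottom of the collar lies in the `X`-side piece `P ∖ outerB (1/2)` (its partner in
`Y` has `h₂`-radius `1/2`). [folklore] -/
theorem collar_zero_mem (v : unitHalfSphere n) : D.collar (v, 0) ∈ (D.outerB (1 / 2))ᶜ := by
  rw [collar_zero, D.jA_discPtA_eq v one_half_pos one_half_lt_one]
  rintro ⟨b, hb, heq⟩
  have hb' : b = D.discPtB v (sub_pos.2 one_half_lt_one) := D.embB.injective heq
  subst hb'
  exact hb ((dilate_mem_image_closedHalfBall_iff D.emb₂.injective v.2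
    (sub_pos.2 one_half_lt_one).le _).2 (by norm_num))

/-- Every seam point is a bottom point of the collar. [folklore] -/
theorem exists_collar_zero_eq {p : P} (hp : p ∈ (D.outerB (1 / 2))ᶜ ∩ (D.outerA (1 / 2))ᶜ) :
    ∃ v, D.collar (v, 0) = p := by
  obtain ⟨v, hv⟩ := D.exists_eq_of_not_mem hp.1 hp.2
  exact ⟨v, (D.collar_zero v).trans hv⟩

/-- Beyond the open collar: `(P ∖ outerA (1/2)) ∖ κ (A × [0, 1)) = P ∖ outerA (1/4)`, a closed
set. [folklore] -/
theorem compl_outerA_diff_eq :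
    (D.outerA (1 / 2))ᶜ \ D.collar '' {q | q.2 < 1} = (D.outerA (1 / 4))ᶜ := by
  apply Subset.antisymm
  · rintro p ⟨hp1, hp2⟩ ⟨a, ha, rfl⟩
    -- `a ∈ h₁ {‖w‖ ≤ 1/2}` (else `jA a ∈ outerA (1/2)`), so `a = h₁ (t v)` with `1/4 < t ≤ 1/2`
    have ha2 : (a : X) ∈ D.h₁ '' {w : EuclideanHalfSpace n | ‖w.val‖ ≤ 1 / 2} := by
      by_contra h
      exact hp1 ⟨a, h, rfl⟩
    obtain ⟨w, hw, hwa⟩ := ha2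
    obtain ⟨v, ht, rfl⟩ := D.exists_eq_discPtA hwa
    have ht4 : 1 / 4 < ‖w.val‖ := by
      by_contra h
      exact ha ((dilate_mem_image_closedHalfBall_iff D.emb₁.injective v.2 ht.le _).2 (not_lt.1 h))
    -- the collar parameter `s = 2 - 4t ∈ [0, 1)`
    have hs : (2 - 4 * ‖w.val‖) ∈ Icc (0 : ℝ) 1 := ⟨by linarith [show ‖w.val‖ ≤ 1 / 2 from hw], by linarith⟩
    refine hp2 ⟨(v, ⟨2 - 4 * ‖w.val‖, hs⟩), ?_, ?_⟩
    · show (⟨2 - 4 * ‖w.val‖, hs⟩ : I) < 1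
      exact Subtype.mk_lt_mk.2 (by linarith)
    · simp only [collar]
      congr 1
      exact Subtype.ext (by simp [discPtA, cRad]; ring_nf)
  · intro p hp
    refine ⟨fun h => hp (D.outerA_mono (by norm_num) h), ?_⟩
    rintro ⟨⟨v, s⟩, hs, rfl⟩
    exact hp ⟨_, fun h => (not_le.2 (quarter_lt_cRad hs))
      ((dilate_mem_image_closedHalfBall_iff D.emb₁.injective v.2 (cRad_pos s).le _).1 h), rfl⟩

variable [T2Space P]

/-- The collar is a closed embedding (`P` Hausdorff; its source is compact). [folklore] -/
theorem isClosedEmbedding_collar : IsClosedEmbedding D.collar :=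
  D.continuous_collar.isClosedEmbedding D.collar_injective

/-- **The collared cover of a boundary connected sum**: `X' = P ∖ outerB (1/2)` (the `X`-side),
`Y' = P ∖ outerA (1/2)` (the `Y`-side), meeting along the seam `jA (h₁ {‖w‖ = 1/2})`, with the
collar `κ (v, s) = jA (h₁ ((1/2 - s/4) v))` inside `Y'`. [folklore] -/
def collaredCover : Literature.AlgebraicTopology.Homotopy.CollaredCover P (unitHalfSphere n) where
  left := (D.outerB (1 / 2))ᶜ
  right := (D.outerA (1 / 2))ᶜ
  isClosed_left := (D.symm.isOpen_outerA (1 / 2)).isClosed_compl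
  isClosed_right := (D.isOpen_outerA (1 / 2)).isClosed_compl
  union_eq := by
    rw [← compl_inter, inter_comm, D.outerA_inter_outerB, compl_empty]
  collar := D.collar
  isClosedEmbedding_collar := D.isClosedEmbedding_collar
  collar_mem_right := D.collar_mem
  collar_zero_mem_left := D.collar_zero_mem
  exists_collar_zero_eq p hp := D.exists_collar_zero_eq hp
  isClosed_right_diff := by
    rw [D.compl_outerA_diff_eq]
    exact (D.isOpen_outerA (1 / 4)).isClosed_compl

end BCSData

/-- **A boundary connected sum of contractible spaces is contractible** (topological data
version). [folklore] -/
theorem BCSData.contractibleSpace [T2Space P] (D : BCSData n X Y P) [ContractibleSpace X]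
    [ContractibleSpace Y] :
    ContractibleSpace P :=
  haveI := contractibleSpace_unitHalfSphere (n := n)
  D.collaredCover.contractibleSpace D.contractibleSpace_compl_outerB D.contractibleSpace_compl_outerA

end BCS

/-! ### §5 The named fact -/

/-- **Discharge of `Literature.Topology.FourManifolds.contractibleSpace_of_isOpenGluing_boundaryConnectedSumRel`**: a boundary
connected sum (open gluing of the punctured pieces along `boundaryConnectedSumRel h₁ h₂`, for
half-discs with open ranges) of contractible `X`, `Y` is contractible. The smooth structures in
the statement play no role: only the topological embeddings and the identification are used
(`BCSData.contractibleSpace`). This is why Matveyev's new corks `W₁ ♮ W₂` (1996, proof of part 2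
of the Theorem, fig. 2) are again contractible. [cite: Matveyev1996, proof of Theorem part 2, fig. 2] -/
theorem contractibleSpace_of_isOpenGluing_boundaryConnectedSumRel_holds :
    contractibleSpace_of_isOpenGluing_boundaryConnectedSumRel.{u} := by
  intro n _ X Y P _ _ _ _ _ _ _ _ _ _ _ _ _ _ _ h₁ h₂ hX hY e₁ o₁ e₂ o₂ hG
  obtain ⟨jA, jB, hjA, hjAo, hjB, hjBo, hU, hR⟩ := hG
  let D : BCSData n X Y P :=
    { h₁ := h₁, h₂ := h₂, emb₁ := e₁.isEmbedding, isOpen_range₁ := o₁, emb₂ := e₂.isEmbedding,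
      isOpen_range₂ := o₂, jA := jA, jB := jB, embA := ⟨hjA.isEmbedding, hjAo⟩,
      embB := ⟨hjB.isEmbedding, hjBo⟩, union_range := hU, rel_iff := hR }
  exact D.contractibleSpace

end Literature.Topology.FourManifolds
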